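import Mathlib.Analysis.Matrix.Order
import Mathlib.Analysis.SpecialFunctions.ContinuousFunctionalCalculus.Rpow.Basic
import Literature.MathematicalPhysics.QuantumLattice.HubbardNNNHoppingOpenClusters
import Literature.MathematicalPhysics.QuantumLattice.HubbardTorusPlaquetteDressedBound
import Literature.MathematicalPhysics.QuantumLattice.BootstrapCertificateDuality
import Literature.MathematicalPhysics.QuantumLattice.HubbardStateSectorDecomposition
import Literature.MathematicalPhysics.QuantumLattice.HubbardModelParticleHoleProofs
import HarnessLib

/-!
# Cluster-embedding machinery for Anderson-type lower bounds on the `t–t'–U` Hubbard torus (part I)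

Anderson's cluster argument (Phys. Rev. 83 (1951) 1260, eq. (2)): write a translation-invariant
lattice Hamiltonian `H` as a sum of copies of one cluster Hamiltonian `h_C` transported to every
translate of the cluster; since each transported copy is bounded below (as an operator on the FULL
Fock space) by the spectral floor of `h_C`, `H` is bounded below by the number of clusters times that
floor. For fermions the transport map is the canonical embedding `Γ(φ) = fermionEmbed φ` of the
cluster CAR algebra (`InfVolFermionState.lean`), and two facts make the argument rigorous on the
`a × b` torus of the `t–t'–U` model of LeBlanc et al., Phys. Rev. X 5 (2015) 041041, eq. (1)
(`hubbardRectTorusTT'`, `HubbardNNNHopping.lean`):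

* **positivity transfer** (this file, §1): `Γ(φ)` is a unital `*`-homomorphism, hence maps
  `h - σ·1 ⪰ 0` to `Γ(φ) h - σ·1 ⪰ 0`; and a particle-number conserving Hermitian `h` whose every
  sector ground energy is `≥ m` satisfies `h - m·1 ⪰ 0` (decomposition of a vector into its
  particle-number components) — so per-sector exact-diagonalisation floors of the cluster become an
  operator inequality that survives the embedding (`le_groundEnergy_fermionEmbed_of_posSemidef`,
  `posSemidef_sub_smul_one_of_forall_le_groundEnergy`);
* **translation structure** (this file, §2): on `ℤ/aℤ × ℤ/bℤ` (`a, b ≥ 3`) the nearest neighbours of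
  `x` are exactly the four translates `x ± e₁, x ± e₂` and the diagonal neighbours the four translates
  `x + (±1, ±1)`, so the `t–t'` Hamiltonian is `-t Σ_{d ∈ {±e₁, ±e₂}} T_d - t' Σ_{d ∈ {(±1,±1)}} T_d
  + U Σ_x n_{x↑} n_{x↓}` with the directed hoppings `T_d = Σ_{x,σ} c†_{xσ} c_{x+d,σ}`
  (`hamiltonian_fermionRectTorusGraph_eq_hopDir`, `hamiltonian_fermionRectTorusDiagGraph_eq_hopDir`),
  and sums over the torus are translation invariant (`sum_shiftPt`).

Part II (the covering identity `Σ_g [Γ(ι_g) h_{2×3} + Γ(ι'_g) h_{3×2}] = H + 12 μ N̂` for the weighted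
open-box Hamiltonian `hubbardOpenBoxTT' 2 3 (t/7) (t'/4) (U/12) + μ N̂` of
`HubbardNNNHoppingOpenClusters.lean`, and the resulting bound
`E₀(a, b; N) ≥ 2ab · min_k (σ_k + μ k) - 12 μ N`) is built on these lemmas.
References: P. W. Anderson, Phys. Rev. 83 (1951) 1260 [cite: Anderson1951, eq. (2)];
D. Ruelle, *Statistical Mechanics* (1969) §3.3 (cluster decompositions of lattice energies)
[cite: Ruelle1969, §3.3]; LeBlanc et al. (Simons Collaboration), Phys. Rev. X 5 (2015) 041041
[cite: LeBlancEtAl2015, eq. (1)]; E. H. Lieb, arXiv:cond-mat/9311033 §2 (sectors, ground energies)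
[cite: arXiv9311033, §2].
-/

noncomputable section

namespace Literature.MathematicalPhysics.QuantumLattice

open Matrix Finset HubbardWave0
open scoped ComplexOrder

/-! ### Positivity is preserved by `*`-maps -/

section PSDTransfer

variable {n n' : Type*} [Fintype n] [DecidableEq n] [Fintype n'] [DecidableEq n']

open scoped MatrixOrder in
/-- A positive semidefinite complex matrix is `Sᴴ S` for its (self-adjoint) square root. [folklore] -/
private theorem PosSemidef.exists_conjTranspose_mul_self_eq' {A : Matrix n n ℂ} (hA : A.PosSemidef) :
    ∃ S : Matrix n n ℂ, Sᴴ * S = A := by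
  refine ⟨CFC.sqrt A, ?_⟩
  have hs : (CFC.sqrt A)ᴴ = CFC.sqrt A := (CFC.sqrt_nonneg A).isSelfAdjoint
  rw [hs]
  exact CFC.sqrt_mul_sqrt_self A hA.nonneg

omit [DecidableEq n'] in
/-- A map sending `aᴴ a ↦ (Γ a)ᴴ (Γ a)` preserves positive semidefiniteness. [folklore] -/
private theorem posSemidef_map_of_conjTranspose_mul_self (Γ : Matrix n n ℂ → Matrix n' n' ℂ)
    (hΓ : ∀ a : Matrix n n ℂ, Γ (aᴴ * a) = (Γ a)ᴴ * Γ a) {A : Matrix n n ℂ} (hA : A.PosSemidef) :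
    (Γ A).PosSemidef := by
  obtain ⟨S, hS⟩ := PosSemidef.exists_conjTranspose_mul_self_eq' hA
  rw [← hS, hΓ]
  exact posSemidef_conjTranspose_mul_self _

end PSDTransfer

section Embed

variable {Λ₀ Λ : Type*} [LinearOrder Λ₀] [Fintype Λ₀] [LinearOrder Λ] [Fintype Λ]

/-- `Γ(φ)` preserves positive semidefiniteness. [cite: Anderson1951, eq. (2)] -/
theorem posSemidef_fermionEmbed (φ : Λ₀ ↪ Λ) {A : Matrix (Finset (Orb Λ₀)) (Finset (Orb Λ₀)) ℂ}
    (hA : A.PosSemidef) : (fermionEmbed φ A).PosSemidef :=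
  posSemidef_map_of_conjTranspose_mul_self (fermionEmbed φ) (fermionEmbed_conjTranspose_mul_self φ) hA

/-- `h - σ ⪰ 0 ⇒ Γ(φ) h - σ ⪰ 0` (`Γ(φ)` is unital). [cite: Anderson1951, eq. (2)] -/
theorem posSemidef_fermionEmbed_sub_smul_one (φ : Λ₀ ↪ Λ)
    {h : Matrix (Finset (Orb Λ₀)) (Finset (Orb Λ₀)) ℂ} {σ : ℝ}
    (hpos : (h - (σ : ℂ) • (1 : Matrix (Finset (Orb Λ₀)) (Finset (Orb Λ₀)) ℂ)).PosSemidef) :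
    (fermionEmbed φ h - (σ : ℂ) • (1 : Matrix (Finset (Orb Λ)) (Finset (Orb Λ)) ℂ)).PosSemidef := by
  have h1 := posSemidef_fermionEmbed φ hpos
  rwa [fermionEmbed_sub, fermionEmbed_smul, fermionEmbed_one] at h1

/-- **Spectral floor transfer through `Γ(φ)`**: if `h ≥ σ` as an operator on the small Fock space,
then every sector ground energy of `Γ(φ) h` on the big Fock space is `≥ σ` — the embedding step of Anderson's
cluster bound. [cite: Anderson1951, eq. (2)] -/
theorem le_groundEnergy_fermionEmbed_of_posSemidef (φ : Λ₀ ↪ Λ)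
    {h : Matrix (Finset (Orb Λ₀)) (Finset (Orb Λ₀)) ℂ} {σ : ℝ}
    (hpos : (h - (σ : ℂ) • (1 : Matrix (Finset (Orb Λ₀)) (Finset (Orb Λ₀)) ℂ)).PosSemidef)
    {N : ℕ} (hN : N ≤ 2 * Fintype.card Λ) :
    σ ≤ groundEnergy (fermionEmbed φ h) N := by
  refine le_groundEnergy_of_posSemidef_sub_sector (K := 0) (by rw [card_orb]; exact hN)
    (fun ψ _ => by simp) ?_
  rw [sub_zero]
  exact posSemidef_fermionEmbed_sub_smul_one φ hpos

/-- `relabel` preserves positive semidefiniteness. [cite: Anderson1951, eq. (2)] -/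
theorem posSemidef_relabel {ι ι' : Type*} [LinearOrder ι] [Fintype ι] [LinearOrder ι'] [Fintype ι']
    (e : ι ≃ ι') {A : Matrix (Finset ι) (Finset ι) ℂ} (hA : A.PosSemidef) : (relabel e A).PosSemidef :=
  posSemidef_map_of_conjTranspose_mul_self (relabel e)
    (fun a => by rw [relabel_mul, relabel_conjTranspose]) hA

end Embed

/-! ### Sector lower bounds ⇒ an operator lower bound -/

section Sectors

variable {Λ : Type*} [LinearOrder Λ] [Fintype Λ]

/-- **The Rayleigh bound without normalisation** for a general matrix: for an `N`-particle vector `φ`,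
`E₀(H, N) · Re⟨φ, φ⟩ ≤ Re⟨φ, H φ⟩`. [cite: arXiv9311033, §2] -/
theorem re_dotProduct_mulVec_ge_groundEnergy (H : Matrix (Finset (Orb Λ)) (Finset (Orb Λ)) ℂ) {N : ℕ}
    {φ : Fock (Orb Λ)} (hφ : IsNParticle N φ) :
    groundEnergy H N * (star φ ⬝ᵥ φ).re ≤ (star φ ⬝ᵥ (H *ᵥ φ)).re := by
  by_cases h0 : φ = 0
  · subst h0; simp
  obtain ⟨c, hc0, hc1⟩ := exists_smul_unit h0
  have hN : IsNParticle N (c • φ) := fun s hs => by rw [Pi.smul_apply, hφ s hs, smul_zero]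
  have hE := ThermodynamicLimit.groundEnergy_le_re_expect H hN hc1
  have hcc : star c * c = ((‖c‖ ^ 2 : ℝ) : ℂ) := by
    rw [Complex.star_def, Complex.conj_mul', Complex.ofReal_pow]
  have hexp : expect H (c • φ) = ((‖c‖ ^ 2 : ℝ) : ℂ) * (star φ ⬝ᵥ (H *ᵥ φ)) := by
    rw [expect, star_smul, mulVec_smul, smul_dotProduct, dotProduct_smul, smul_smul, hcc, smul_eq_mul]
  have hnorm : ((‖c‖ ^ 2 : ℝ) : ℂ) * (star φ ⬝ᵥ φ) = 1 := by
    rw [← hc1, star_smul, smul_dotProduct, dotProduct_smul, smul_smul, hcc, smul_eq_mul]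
  have hnorm' : ‖c‖ ^ 2 * (star φ ⬝ᵥ φ).re = 1 := by
    have := congrArg Complex.re hnorm
    rwa [Complex.re_ofReal_mul, Complex.one_re] at this
  rw [hexp, Complex.re_ofReal_mul] at hE
  have hpos : 0 ≤ (star φ ⬝ᵥ φ).re := (Complex.nonneg_iff.1 (dotProduct_star_self_nonneg φ)).1
  calc groundEnergy H N * (star φ ⬝ᵥ φ).re
      ≤ (‖c‖ ^ 2 * (star φ ⬝ᵥ (H *ᵥ φ)).re) * (star φ ⬝ᵥ φ).re :=
        mul_le_mul_of_nonneg_right hE hpos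
    _ = (star φ ⬝ᵥ (H *ᵥ φ)).re * (‖c‖ ^ 2 * (star φ ⬝ᵥ φ).re) := by ring
    _ = _ := by rw [hnorm', mul_one]

/-- **Uniform sector bounds give an operator bound**: a Hermitian, particle-number conserving `H`
with `m ≤ E₀(H, N)` in every sector `N ≤ 2|Λ|` satisfies `H - m·1 ⪰ 0` (decompose a vector into
its particle-number components; `H` does not mix them). [cite: arXiv9311033, §2] -/
theorem posSemidef_sub_smul_one_of_forall_le_groundEnergy
    {H : Matrix (Finset (Orb Λ)) (Finset (Orb Λ)) ℂ} (hH : H.IsHermitian)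
    (hHN : Commute H totalNumber) {m : ℝ} (hm : ∀ N ≤ 2 * Fintype.card Λ, m ≤ groundEnergy H N) :
    (H - (m : ℂ) • (1 : Matrix (Finset (Orb Λ)) (Finset (Orb Λ)) ℂ)).PosSemidef := by
  classical
  set R := range (Fintype.card (Orb Λ) + 1) with hR
  have hherm : (H - (m : ℂ) • (1 : Matrix (Finset (Orb Λ)) (Finset (Orb Λ)) ℂ)).IsHermitian := by
    refine hH.sub ?_
    rw [Matrix.IsHermitian, conjTranspose_smul, conjTranspose_one, Complex.star_def, Complex.conj_ofReal]
  refine Matrix.PosSemidef.of_dotProduct_mulVec_nonneg hherm fun x => ?_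
  have him := im_dotProduct_mulVec_self_of_isHermitian hherm x
  rw [Complex.nonneg_iff]
  refine ⟨?_, him.symm⟩
  have hdecomp : star x ⬝ᵥ (H *ᵥ x) = ∑ N ∈ R, star (numberProj N *ᵥ x) ⬝ᵥ (H *ᵥ (numberProj N *ᵥ x)) := by
    conv_lhs => rw [← sum_numberProj_mulVec x]
    rw [star_sum, sum_dotProduct, mulVec_sum]
    refine Finset.sum_congr rfl fun N _ => ?_
    rw [dotProduct_sum]
    refine Finset.sum_eq_single N (fun M _ hMN => ?_) (fun h => absurd (by assumption) h)
    exact ThermodynamicLimit.dotProduct_eq_zero_of_isNParticle_ne (isNParticle_numberProj_mulVec N x)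
      (LiebTwo.isNParticle_mulVec_of_commute (isNParticle_numberProj_mulVec M x) hHN.symm.eq) (Ne.symm hMN)
  have hnormdecomp : star x ⬝ᵥ x = ∑ N ∈ R, star (numberProj N *ᵥ x) ⬝ᵥ (numberProj N *ᵥ x) := by
    have hx : star x ⬝ᵥ x = star x ⬝ᵥ (∑ N ∈ R, numberProj N *ᵥ x) := by rw [sum_numberProj_mulVec]
    rw [hx, dotProduct_sum]
    exact Finset.sum_congr rfl fun N _ => dotProduct_numberProj_mulVec N x
  rw [sub_mulVec, dotProduct_sub, smul_mulVec, one_mulVec, dotProduct_smul, smul_eq_mul, hdecomp, hnormdecomp,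
    Finset.mul_sum, Complex.sub_re, Complex.re_sum, Complex.re_sum, ← Finset.sum_sub_distrib]
  refine Finset.sum_nonneg fun N hNR => ?_
  have hNle : N ≤ 2 * Fintype.card Λ := by
    rw [← card_orb]; exact Nat.lt_succ_iff.mp (Finset.mem_range.mp hNR)
  rw [Complex.re_ofReal_mul, sub_nonneg]
  have hpos : 0 ≤ (star (numberProj N *ᵥ x) ⬝ᵥ (numberProj N *ᵥ x)).re :=
    (Complex.nonneg_iff.1 (dotProduct_star_self_nonneg _)).1
  exact (mul_le_mul_of_nonneg_right (hm N hNle) hpos).trans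
    (re_dotProduct_mulVec_ge_groundEnergy H (isNParticle_numberProj_mulVec N x))

end Sectors


/-! ### Translations of the rectangular torus `ℤ/aℤ × ℤ/bℤ` (representatives in `Fin a ×ₗ Fin b`) -/

section TorusShifts

variable {a b : ℕ}

/-- Reduction modulo `a` of a number below `2a`. [folklore] -/
private theorem mod_eq_ite_of_lt_two_mul {m a : ℕ} (h : m < 2 * a) :
    m % a = if m < a then m else m - a := by
  split_ifs with hm
  · exact Nat.mod_eq_of_lt hm
  · rw [Nat.mod_eq_sub_mod (Nat.le_of_not_lt hm)]
    exact Nat.mod_eq_of_lt (by omega)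

/-- Translation of residues is injective on residues. [folklore] -/
private theorem eq_of_add_mod_eq {a u v d : ℕ} (hu : u < a) (hv : v < a)
    (h : (u + d) % a = (v + d) % a) : u = v :=
  Nat.ModEq.eq_of_lt_of_lt (Nat.ModEq.add_right_cancel' d h) hu hv

/-- The translate `x + (d₁, d₂)` of a site of the torus `ℤ/aℤ × ℤ/bℤ` (on representatives): the
translation group of the periodic cluster. [cite: LeBlancEtAl2015, eq. (1)] -/
def shiftPt (d₁ d₂ : ℕ) (x : Fin a ×ₗ Fin b) : Fin a ×ₗ Fin b :=
  toLex (⟨(((ofLex x).1 : ℕ) + d₁) % a, Nat.mod_lt _ (ofLex x).1.pos⟩,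
    ⟨(((ofLex x).2 : ℕ) + d₂) % b, Nat.mod_lt _ (ofLex x).2.pos⟩)

/-- First coordinate of a translate. [folklore] -/
@[simp] private theorem shiftPt_fst_val (d₁ d₂ : ℕ) (x : Fin a ×ₗ Fin b) :
    (((ofLex (shiftPt d₁ d₂ x)).1 : Fin a) : ℕ) = (((ofLex x).1 : ℕ) + d₁) % a := rfl

/-- Second coordinate of a translate. [folklore] -/
@[simp] private theorem shiftPt_snd_val (d₁ d₂ : ℕ) (x : Fin a ×ₗ Fin b) :
    (((ofLex (shiftPt d₁ d₂ x)).2 : Fin b) : ℕ) = (((ofLex x).2 : ℕ) + d₂) % b := rfl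

/-- Two sites are equal iff their coordinates are. [folklore] -/
private theorem lexSite_eq_iff (x y : Fin a ×ₗ Fin b) :
    x = y ↔ ((ofLex x).1 : ℕ) = (ofLex y).1 ∧ ((ofLex x).2 : ℕ) = (ofLex y).2 := by
  constructor
  · rintro rfl; exact ⟨rfl, rfl⟩
  · rintro ⟨h1, h2⟩
    exact ofLex.injective (Prod.ext (Fin.ext h1) (Fin.ext h2))

/-- `y = x + d` in coordinates. [folklore] -/
private theorem eq_shiftPt_iff (d₁ d₂ : ℕ) (x y : Fin a ×ₗ Fin b) :
    y = shiftPt d₁ d₂ x ↔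
      ((ofLex y).1 : ℕ) = (((ofLex x).1 : ℕ) + d₁) % a ∧ ((ofLex y).2 : ℕ) = (((ofLex x).2 : ℕ) + d₂) % b := by
  rw [lexSite_eq_iff]; rfl

/-- Translations are periodic in the first offset. [cite: LeBlancEtAl2015, eq. (1)] -/
theorem shiftPt_add_period_fst (d₁ d₂ : ℕ) (x : Fin a ×ₗ Fin b) :
    shiftPt (d₁ + a) d₂ x = shiftPt d₁ d₂ x := by
  rw [lexSite_eq_iff, shiftPt_fst_val, shiftPt_fst_val, shiftPt_snd_val, shiftPt_snd_val, ← add_assoc,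
    Nat.add_mod_right]
  exact ⟨rfl, rfl⟩

/-- Translations are periodic in the second offset. [cite: LeBlancEtAl2015, eq. (1)] -/
theorem shiftPt_add_period_snd (d₁ d₂ : ℕ) (x : Fin a ×ₗ Fin b) :
    shiftPt d₁ (d₂ + b) x = shiftPt d₁ d₂ x := by
  rw [lexSite_eq_iff, shiftPt_fst_val, shiftPt_fst_val, shiftPt_snd_val, shiftPt_snd_val, ← add_assoc,
    Nat.add_mod_right]
  exact ⟨rfl, rfl⟩

/-- The trivial translation. [folklore] -/
@[simp] private theorem shiftPt_zero_zero (x : Fin a ×ₗ Fin b) : shiftPt 0 0 x = x := by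
  rw [eq_comm, eq_shiftPt_iff, add_zero, add_zero, Nat.mod_eq_of_lt (ofLex x).1.isLt,
    Nat.mod_eq_of_lt (ofLex x).2.isLt]
  exact ⟨rfl, rfl⟩

/-- Translations compose additively. [cite: LeBlancEtAl2015, eq. (1)] -/
theorem shiftPt_shiftPt (d₁ d₂ e₁ e₂ : ℕ) (x : Fin a ×ₗ Fin b) :
    shiftPt e₁ e₂ (shiftPt d₁ d₂ x) = shiftPt (d₁ + e₁) (d₂ + e₂) x := by
  rw [lexSite_eq_iff, shiftPt_fst_val, shiftPt_fst_val, shiftPt_snd_val, shiftPt_snd_val, shiftPt_fst_val,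
    shiftPt_snd_val, Nat.mod_add_mod, Nat.mod_add_mod, add_assoc, add_assoc]
  exact ⟨rfl, rfl⟩

/-- A translation is injective. [folklore] -/
private theorem shiftPt_injective (d₁ d₂ : ℕ) : Function.Injective (shiftPt (a := a) (b := b) d₁ d₂) := by
  intro x y h
  rw [lexSite_eq_iff, shiftPt_fst_val, shiftPt_fst_val, shiftPt_snd_val, shiftPt_snd_val] at h
  rw [lexSite_eq_iff]
  exact ⟨eq_of_add_mod_eq (ofLex x).1.isLt (ofLex y).1.isLt h.1,
    eq_of_add_mod_eq (ofLex x).2.isLt (ofLex y).2.isLt h.2⟩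

/-- A translation is a bijection of the torus. [cite: LeBlancEtAl2015, eq. (1)] -/
theorem shiftPt_bijective (d₁ d₂ : ℕ) : Function.Bijective (shiftPt (a := a) (b := b) d₁ d₂) :=
  (shiftPt_injective d₁ d₂).bijective_of_finite

/-- **Translation invariance of sums over the torus**: `Σ_x F(x + d) = Σ_x F(x)`. [cite: LeBlancEtAl2015, eq. (1)] -/
theorem sum_shiftPt {M : Type*} [AddCommMonoid M] (d₁ d₂ : ℕ) (F : Fin a ×ₗ Fin b → M) :
    ∑ x, F (shiftPt d₁ d₂ x) = ∑ x, F x :=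
  (shiftPt_bijective d₁ d₂).sum_comp F

/-- Ring adjacency on `ℤ/aℤ` (`a ≥ 2`) in terms of the translates `u + 1`, `u + (a - 1)`.
[cite: LeBlancEtAl2015, eq. (1)] -/
theorem ringAdj_iff_eq_mod {a : ℕ} (ha : 2 ≤ a) {u v : ℕ} (hu : u < a) (hv : v < a) :
    ringAdj a u v ↔ v = (u + 1) % a ∨ v = (u + (a - 1)) % a := by
  unfold ringAdj
  rw [mod_eq_ite_of_lt_two_mul (m := u + 1) (by omega), mod_eq_ite_of_lt_two_mul (m := v + 1) (by omega),
    mod_eq_ite_of_lt_two_mul (m := u + (a - 1)) (by omega)]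
  split_ifs <;> omega

/-- Distinct offsets below `a` give distinct translates (first coordinate). [folklore] -/
private theorem shiftPt_ne_of_fst {d₁ d₁' d₂ d₂' : ℕ} (hd : d₁ < a) (hd' : d₁' < a) (h : d₁ ≠ d₁')
    (x : Fin a ×ₗ Fin b) : shiftPt d₁ d₂ x ≠ shiftPt d₁' d₂' x := by
  intro heq
  rw [lexSite_eq_iff, shiftPt_fst_val, shiftPt_fst_val, add_comm _ d₁, add_comm _ d₁'] at heq
  exact h (eq_of_add_mod_eq hd hd' heq.1)

/-- Distinct offsets below `b` give distinct translates (second coordinate). [folklore] -/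
private theorem shiftPt_ne_of_snd {d₁ d₁' d₂ d₂' : ℕ} (hd : d₂ < b) (hd' : d₂' < b) (h : d₂ ≠ d₂')
    (x : Fin a ×ₗ Fin b) : shiftPt d₁ d₂ x ≠ shiftPt d₁' d₂' x := by
  intro heq
  rw [lexSite_eq_iff, shiftPt_snd_val, shiftPt_snd_val, add_comm _ d₂, add_comm _ d₂'] at heq
  exact h (eq_of_add_mod_eq hd hd' heq.2)

/-- **Nearest neighbours on the torus are the four translates `x ± e₁`, `x ± e₂`** (`a, b ≥ 2`).
[cite: LeBlancEtAl2015, eq. (1)] -/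
theorem fermionRectTorusGraph_adj_iff_shift (ha : 2 ≤ a) (hb : 2 ≤ b) (x y : Fin a ×ₗ Fin b) :
    (fermionRectTorusGraph a b).Adj x y ↔
      y = shiftPt 1 0 x ∨ y = shiftPt (a - 1) 0 x ∨ y = shiftPt 0 1 x ∨ y = shiftPt 0 (b - 1) x := by
  rw [fermionRectTorusGraph_adj_iff, eq_shiftPt_iff, eq_shiftPt_iff, eq_shiftPt_iff, eq_shiftPt_iff,
    ringAdj_iff_eq_mod ha (ofLex x).1.isLt (ofLex y).1.isLt,
    ringAdj_iff_eq_mod hb (ofLex x).2.isLt (ofLex y).2.isLt, add_zero, add_zero,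
    Nat.mod_eq_of_lt (ofLex x).1.isLt, Nat.mod_eq_of_lt (ofLex x).2.isLt, Fin.ext_iff, Fin.ext_iff]
  tauto

/-- **Diagonal neighbours on the torus are the four translates `x + (±1, ±1)`** (`a, b ≥ 2`).
[cite: LeBlancEtAl2015, eq. (1)] -/
theorem fermionRectTorusDiagGraph_adj_iff_shift (ha : 2 ≤ a) (hb : 2 ≤ b) (x y : Fin a ×ₗ Fin b) :
    (fermionRectTorusDiagGraph a b).Adj x y ↔
      y = shiftPt 1 1 x ∨ y = shiftPt 1 (b - 1) x ∨ y = shiftPt (a - 1) 1 x ∨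
        y = shiftPt (a - 1) (b - 1) x := by
  rw [fermionRectTorusDiagGraph_adj_iff, eq_shiftPt_iff, eq_shiftPt_iff, eq_shiftPt_iff, eq_shiftPt_iff,
    ringAdj_iff_eq_mod ha (ofLex x).1.isLt (ofLex y).1.isLt,
    ringAdj_iff_eq_mod hb (ofLex x).2.isLt (ofLex y).2.isLt]
  tauto

/-- **A nearest-neighbour bond sum at a site is the sum over the four translates** (`a, b ≥ 3`, so
that the four neighbours are distinct). [cite: LeBlancEtAl2015, eq. (1)] -/
theorem sum_ite_fermionRectTorusGraph_adj (ha : 3 ≤ a) (hb : 3 ≤ b) {M : Type*} [AddCommMonoid M]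
    (x : Fin a ×ₗ Fin b) (F : Fin a ×ₗ Fin b → M) :
    (∑ y, if (fermionRectTorusGraph a b).Adj x y then F y else 0) =
      F (shiftPt 1 0 x) + F (shiftPt (a - 1) 0 x) + F (shiftPt 0 1 x) + F (shiftPt 0 (b - 1) x) := by
  classical
  rw [← Finset.sum_filter]
  have hS : Finset.univ.filter (fun y => (fermionRectTorusGraph a b).Adj x y) =
      {shiftPt 1 0 x, shiftPt (a - 1) 0 x, shiftPt 0 1 x, shiftPt 0 (b - 1) x} := by
    ext y
    simp only [Finset.mem_filter, Finset.mem_univ, true_and, Finset.mem_insert, Finset.mem_singleton]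
    exact fermionRectTorusGraph_adj_iff_shift (by omega) (by omega) x y
  have h12 : shiftPt 1 0 x ≠ shiftPt (a - 1) 0 x := shiftPt_ne_of_fst (by omega) (by omega) (by omega) x
  have h13 : shiftPt 1 0 x ≠ shiftPt 0 1 x := shiftPt_ne_of_snd (by omega) (by omega) (by omega) x
  have h14 : shiftPt 1 0 x ≠ shiftPt 0 (b - 1) x := shiftPt_ne_of_snd (by omega) (by omega) (by omega) x
  have h23 : shiftPt (a - 1) 0 x ≠ shiftPt 0 1 x := shiftPt_ne_of_snd (by omega) (by omega) (by omega) x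
  have h24 : shiftPt (a - 1) 0 x ≠ shiftPt 0 (b - 1) x :=
    shiftPt_ne_of_snd (by omega) (by omega) (by omega) x
  have h34 : shiftPt 0 1 x ≠ shiftPt 0 (b - 1) x := shiftPt_ne_of_snd (by omega) (by omega) (by omega) x
  rw [hS, Finset.sum_insert (by simp [h12, h13, h14]), Finset.sum_insert (by simp [h23, h24]),
    Finset.sum_insert (by simp [h34]), Finset.sum_singleton]
  simp only [add_assoc]

/-- **A diagonal bond sum at a site is the sum over the four diagonal translates** (`a, b ≥ 3`).
[cite: LeBlancEtAl2015, eq. (1)] -/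
theorem sum_ite_fermionRectTorusDiagGraph_adj (ha : 3 ≤ a) (hb : 3 ≤ b) {M : Type*} [AddCommMonoid M]
    (x : Fin a ×ₗ Fin b) (F : Fin a ×ₗ Fin b → M) :
    (∑ y, if (fermionRectTorusDiagGraph a b).Adj x y then F y else 0) =
      F (shiftPt 1 1 x) + F (shiftPt 1 (b - 1) x) + F (shiftPt (a - 1) 1 x) +
        F (shiftPt (a - 1) (b - 1) x) := by
  classical
  rw [← Finset.sum_filter]
  have hS : Finset.univ.filter (fun y => (fermionRectTorusDiagGraph a b).Adj x y) =
      {shiftPt 1 1 x, shiftPt 1 (b - 1) x, shiftPt (a - 1) 1 x, shiftPt (a - 1) (b - 1) x} := by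
    ext y
    simp only [Finset.mem_filter, Finset.mem_univ, true_and, Finset.mem_insert, Finset.mem_singleton]
    exact fermionRectTorusDiagGraph_adj_iff_shift (by omega) (by omega) x y
  have h12 : shiftPt 1 1 x ≠ shiftPt 1 (b - 1) x := shiftPt_ne_of_snd (by omega) (by omega) (by omega) x
  have h13 : shiftPt 1 1 x ≠ shiftPt (a - 1) 1 x := shiftPt_ne_of_fst (by omega) (by omega) (by omega) x
  have h14 : shiftPt 1 1 x ≠ shiftPt (a - 1) (b - 1) x :=
    shiftPt_ne_of_fst (by omega) (by omega) (by omega) x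
  have h23 : shiftPt 1 (b - 1) x ≠ shiftPt (a - 1) 1 x :=
    shiftPt_ne_of_fst (by omega) (by omega) (by omega) x
  have h24 : shiftPt 1 (b - 1) x ≠ shiftPt (a - 1) (b - 1) x :=
    shiftPt_ne_of_fst (by omega) (by omega) (by omega) x
  have h34 : shiftPt (a - 1) 1 x ≠ shiftPt (a - 1) (b - 1) x :=
    shiftPt_ne_of_snd (by omega) (by omega) (by omega) x
  rw [hS, Finset.sum_insert (by simp [h12, h13, h14]), Finset.sum_insert (by simp [h23, h24]),
    Finset.sum_insert (by simp [h34]), Finset.sum_singleton]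
  simp only [add_assoc]

/-- **Directed hopping along a lattice vector**: `T_d = Σ_{x,σ} c†_{xσ} c_{x+d,σ}` on the torus (the
hopping term of the periodic `t–t'` Hamiltonian along one bond direction). [cite: LeBlancEtAl2015, eq. (1)] -/
def hopDir (a b d₁ d₂ : ℕ) : Matrix (Finset (Orb (Fin a ×ₗ Fin b))) (Finset (Orb (Fin a ×ₗ Fin b))) ℂ :=
  ∑ x : Fin a ×ₗ Fin b, ∑ σ : Fin 2, creation (orb x σ) * annihilation (orb (shiftPt d₁ d₂ x) σ)

/-- `T_{d + a e₁} = T_d`. [cite: LeBlancEtAl2015, eq. (1)] -/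
theorem hopDir_add_period_fst (a b d₁ d₂ : ℕ) : hopDir a b (d₁ + a) d₂ = hopDir a b d₁ d₂ := by
  unfold hopDir; simp_rw [shiftPt_add_period_fst]

/-- `T_{d + b e₂} = T_d`. [cite: LeBlancEtAl2015, eq. (1)] -/
theorem hopDir_add_period_snd (a b d₁ d₂ : ℕ) : hopDir a b d₁ (d₂ + b) = hopDir a b d₁ d₂ := by
  unfold hopDir; simp_rw [shiftPt_add_period_snd]

/-- **The nearest-neighbour Hubbard Hamiltonian of the torus `ℤ/aℤ × ℤ/bℤ` (`a, b ≥ 3`) in terms of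
directed hoppings**: `H = -t (T_{e₁} + T_{-e₁} + T_{e₂} + T_{-e₂}) + U Σ_x n_{x↑} n_{x↓}`.
[cite: LeBlancEtAl2015, eq. (1)] -/
theorem hamiltonian_fermionRectTorusGraph_eq_hopDir (ha : 3 ≤ a) (hb : 3 ≤ b) (t U : ℝ) :
    hamiltonian (fermionRectTorusGraph a b) t U =
      -(t : ℂ) • (hopDir a b 1 0 + hopDir a b (a - 1) 0 + hopDir a b 0 1 + hopDir a b 0 (b - 1)) +
        (U : ℂ) • ∑ x : Fin a ×ₗ Fin b, numberOp x 0 * numberOp x 1 := by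
  rw [hamiltonian]
  congr 2
  simp only [hopDir, ← Finset.sum_add_distrib]
  refine Finset.sum_congr rfl fun x _ => ?_
  rw [Finset.sum_comm]
  refine Finset.sum_congr rfl fun σ _ => ?_
  exact sum_ite_fermionRectTorusGraph_adj ha hb x _

/-- **The diagonal (`t'`) hopping of the torus `ℤ/aℤ × ℤ/bℤ` (`a, b ≥ 3`) in terms of directed
hoppings**: `-t' (T_{(1,1)} + T_{(1,-1)} + T_{(-1,1)} + T_{(-1,-1)})`. [cite: LeBlancEtAl2015, eq. (1)] -/
theorem hamiltonian_fermionRectTorusDiagGraph_eq_hopDir (ha : 3 ≤ a) (hb : 3 ≤ b) (t' : ℝ) :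
    hamiltonian (fermionRectTorusDiagGraph a b) t' 0 =
      -(t' : ℂ) • (hopDir a b 1 1 + hopDir a b 1 (b - 1) + hopDir a b (a - 1) 1 +
        hopDir a b (a - 1) (b - 1)) := by
  rw [hamiltonian, Complex.ofReal_zero, zero_smul, add_zero]
  congr 1
  simp only [hopDir, ← Finset.sum_add_distrib]
  refine Finset.sum_congr rfl fun x _ => ?_
  rw [Finset.sum_comm]
  refine Finset.sum_congr rfl fun σ _ => ?_
  exact sum_ite_fermionRectTorusDiagGraph_adj ha hb x _

end TorusShifts

end Literature.MathematicalPhysics.QuantumLattice
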